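import Summits.QuantumFields.YangMills.Theorems.BalabanUVNodesK0V23Defs

/-!
# K0⁷ V23 — THE «FLOW-GRÖNWALL» ROAD'S GLUE IN THE TREE: discrete Grönwall over scales for box histories (last-level AND full-memory forms, constant source,
# box-restricted one-step rows) and the BY-NAME door from the four one-step rows at the stub's own member to the registered stub-3ᴬ′ᴮ text
# `K0V23Defs.AbsBetaBoxAtThm1WitnessCCMGenGridGZBAt F`

Cell `pub-ymgap`, width seat `pub-ymgap-dag-n07-w3` (g18; N07 [B11] ∕ K0⁷–K1 junction; director-ym №392∕№393: helper lanes stay strictly BELOW the |β|-box statement).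
`--kind proof --supports stmt-QuantumFields-20541 --as helper`, COUNT-NEUTRAL.  NEW leaf; theorems only — 0 `def`, 0 `sorry`; imports `…K0V23Defs` only (route-independent).

WHAT.  The NODE O cover's lens-2 «flow-gronwall-ttel» (crux idea `Cruxes/Record13SepCoPHInhabited/Ideas/flow-gronwall-ttel.md`, seat `ymgap-nodeO-lens-2`; HOME sketches
`ym-nodeO-ideate/nodeO-cover/LENS-2-Sketch-v{0..3}.lean`) reduces the K0 box to ONE-STEP rows on the history box plus a linear gain `θ` with `θ + γΛ < 1`, glued by a
discrete Grönwall induction over the scale index; CRIT-1 (`Cruxes/…/CRIT-1-CUT1-lens2-flow-gronwall-ttel-v0.md`, `…-v2-pinned118.md`, kernels `Crit1Cut1Lens2Sketch.lean`,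
`Crit1Cut1Lens2HistSketch.lean`) asked for two print-faithful repairs — rows restricted to BOX histories (F1) with a coupling-INDEPENDENT source `b₀` (F2a: [I] p.263's `E₀` is
absolute; p.280 recovers it by `O(1)α₂⁻¹ε₁`) and FULL MEMORY (F2b: the step-(k+1) action carries every previous level, (1.7) p.261).  Those kernels live under `Cruxes/` and HOME,
not importable by a Theorems closer.  This file is their TREE home in the repaired shape, over an ABSTRACT history-indexed size functional
`e : (k : ℕ) → (Fin (k + 1) → ℝ) → ℝ` and an abstract `β : HBeta`, then instantiated BY NAME at the stub's own letter-free Z3 member: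
* §1 `size_le_of_stepHistOn` — ★ full-memory Grönwall with constant source (strong induction): one-step row «every previous level `≤ E` ⟹ new level
  `≤ θE + b₀ + g_{k+1}(b₁ + ΛE)`» on `Box γ̄` + base `e 0 ≤ b₀ + g_0 b₁` ⟹ `e k v ≤ (b₀ + γb₁)/(1 − θ − γΛ)` on every `Box γ`, `γ ≤ γ̄`, `θ + γΛ < 1`;
  `size_le_of_stepLastOn` — the last-level row (lens-2's `StepContractionOn` + `b₀`) as the special case.
* §2 `abs_le_of_readoutOn` — readout row `|β_{k+1}(v) − b_{k+1}| ≤ A₀ + A·e_k(init v) + g_{k+1}(a₀ + a₁ e_k(init v))`, base `|β_0(v) − b_0| ≤ A₀ + g_0 a₀`, cap `|b_k| ≤ B`, size bound `M`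
  ⟹ `|β_k(v)| ≤ B + A₀ + A·M + γ(a₀ + a₁M)` on `Box γ` (the constant slack `A₀` absorbs a SECOND, already-bounded size tier — CRIT-1's two-tier triangular system = this lemma twice); `betaBox_of_readoutOn` — the same as `BetaLowerH (−β′) γ β ∧ BetaUpperH β′ γ β`.
* §3 ★★ `absBetaBoxGZBAt_of_flowRowsAt` — LOCATED-B BY NAME: if at every member `(j; B₃ ≥ 2L², B₃′, a₀, a₁ > 0)` of the stub's family SOME `ε₀, ε₂₉, γ > 0`, `γ̄ ≥ γ`, a size functional,
  a centre sequence and constants carry the four rows (full-memory step, base, readout, cap) for THAT member's β of record `betaOfRecord₁₃ F 2 (theta13OfThm1CCMWZB F 2 j (1/2) a₀ ε₀ ε₂₉ B₃ B₃' a₀ a₁ 0 0)`,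
  then `AbsBetaBoxAtThm1WitnessCCMGenGridGZBAt F` (the (8)∕(9) antecedents are not used); `…_of_flowRowsLastAt` — last-level edition.
* §5 (v1.1, append-only) ★★ `fmt_uniform_of_fmtStep` ∕ `fmt_uniform_of_fmtStepMem` — FORMAT-PREDICATE Grönwall (lens-2 LINE v3.11∕v3.12 shapes `FmtStep`∕`FmtStepMem`, CRIT-1 (P3b)(1)).
* §4 ★★ `k0BoxSmallRadiiAt_of_flowRowsHist` — RADIUS-AXIS edition (director-ym №398∕№399): the rows at ONE member per SMALL radius `a₀ ≤ a⋆` ⟹ the body of door (α_small)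
  `K0BoxSmallRadii` at `F`, unfolded (the named door is the NODE O definer's leaf `…K0V23Stub3DoorSuppliers`; compose there ∕ in the line with one `fun F => …`).

HONEST FRAMING (binding).  [folklore] real analysis + a by-name door; the four rows are DISPLAYED HYPOTHESES inhabited nowhere — with `e` unpinned they are an INTERFACE, not a claim
(lens-2's own costume guard: the e-free Lipschitz readout already satisfies them with `e ≡ 0`), and when `e` is the record's pinned size functional the step row IS NODE O's wall at one
step ([I] §1 p.264 «uniformly bounded» ∕ Thm 3's (1.18) heredity, STATED, proof unpublished [II] p.355).  This file prices nothing and discharges nothing of Bałaban; K0⁷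
stmt-QuantumFields-20541 NOT closed; NODE O NOT inhabited; N07 NOT discharged; COUNT 8∕28 · K 1∕4 UNMOVED; R4 = the conditional finite-𝕋⁴ rung `BalabanLadder.UV` only; NOT continuum ∕
ℝ⁴ ∕ OS; the Yang–Mills mass gap (Clay) is NOT proved by any of this.  [I] = [Balaban1987RG1]; [II] = [Balaban1989LargeFieldII].
-/

noncomputable section

namespace Summit.QuantumFields.YangMills.Theorems.K0V23Stub3FlowGronwallDoor

open Literature.MathematicalPhysics.QuantumFieldTheory.Balaban1983to89
open Literature.MathematicalPhysics.QuantumFieldTheory.Balaban1983to89.Node00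
open Literature.MathematicalPhysics.QuantumFieldTheory.Balaban1983to89.T4Continuum
open Literature.MathematicalPhysics.QuantumFieldTheory.Balaban1983to89.FlowStep
open Summit.QuantumFields.YangMills.Theorems.K0V23Defs (AbsBetaBoxAtThm1WitnessCCMGenGridGZBAt)

/-! ## §0. Box histories: coordinates, truncations, monotonicity (private utilities) -/

/-- Membership in the history box, coordinatewise. [folklore] -/
private theorem mem_box_iff {γ : ℝ} {k : ℕ} {v : Fin (k + 1) → ℝ} : v ∈ Box γ k ↔ ∀ i, 0 < v i ∧ v i ≤ γ := by
  simp [Box, Set.mem_Ioc]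

/-- Boxes are monotone in the side. [folklore] -/
private theorem box_mono {γ γ' : ℝ} (hγ : γ ≤ γ') {k : ℕ} {v : Fin (k + 1) → ℝ} (h : v ∈ Box γ k) : v ∈ Box γ' k := by
  rw [mem_box_iff] at h ⊢
  exact fun i => ⟨(h i).1, (h i).2.trans hγ⟩

/-- A truncated box history is a box history. [folklore] -/
private theorem trunc_mem_box {γ : ℝ} {k : ℕ} {v : Fin (k + 1) → ℝ} (hv : v ∈ Box γ k) {j : ℕ} (hj : j + 1 ≤ k + 1) :
    (fun i : Fin (j + 1) => v (Fin.castLE hj i)) ∈ Box γ j := by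
  rw [mem_box_iff] at hv ⊢
  exact fun i => hv _

/-- `Fin.init` is the truncation to the first `k + 1` couplings. [folklore] -/
private theorem init_eq_trunc {k : ℕ} (v : Fin (k + 2) → ℝ) :
    Fin.init v = fun i : Fin (k + 1) => v (Fin.castLE (Nat.le_succ _) i) := by
  funext i
  rfl

/-- `Fin.init` of a box history is a box history. [folklore] -/
private theorem init_mem_box {γ : ℝ} {k : ℕ} {v : Fin (k + 2) → ℝ} (hv : v ∈ Box γ (k + 1)) : Fin.init v ∈ Box γ k := by
  rw [init_eq_trunc]
  exact trunc_mem_box hv (Nat.le_succ _)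

/-! ## §1. Discrete Grönwall over scales for box histories -/

/-- The Grönwall fixed point: `θ·M + b₀ + γ(b₁ + Λ·M) = M` for `M = (b₀ + γb₁)/(1 − θ − γΛ)`, `θ + γΛ < 1`. [folklore] -/
theorem gronwall_fixedPoint {θ b₀ b₁ Λ γ : ℝ} (hgap : θ + γ * Λ < 1) :
    θ * ((b₀ + γ * b₁) / (1 - θ - γ * Λ)) + b₀ + γ * (b₁ + Λ * ((b₀ + γ * b₁) / (1 - θ - γ * Λ))) = (b₀ + γ * b₁) / (1 - θ - γ * Λ) := by
  have h : (1 - θ - γ * Λ) ≠ 0 := by intro h0; linarith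
  field_simp
  ring

/-- The Grönwall level is non-negative for non-negative data. [folklore] -/
theorem gronwall_level_nonneg {θ b₀ b₁ Λ γ : ℝ} (hb₀ : 0 ≤ b₀) (hb₁ : 0 ≤ b₁) (hγ : 0 ≤ γ) (hgap : θ + γ * Λ < 1) :
    0 ≤ (b₀ + γ * b₁) / (1 - θ - γ * Λ) :=
  div_nonneg (by positivity) (by linarith)

/-- **★ DISCRETE GRÖNWALL OVER SCALES — FULL MEMORY, CONSTANT SOURCE, BOX-RESTRICTED ROWS** (CRIT-1's repaired shape F1∕F2a∕F2b of lens-2's glue).  Size functional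
`e k (g_0,…,g_k)`; one-step row on `Box γ̄`: if every previous level of the history is `≤ E` (`E ≥ 0`), the new level is `≤ θE + b₀ + g_{k+1}(b₁ + ΛE)`; base `e 0 (g_0) ≤ b₀ + g_0 b₁`.
Then on every `Box γ` with `γ ≤ γ̄` and `θ + γΛ < 1`: `e k v ≤ (b₀ + γb₁)/(1 − θ − γΛ)`, UNIFORMLY IN `k` (strong induction on the level). [folklore; cite: Balaban1987RG1, (1.7) p.261 and (1.18) p.263 (shape of the inductive clause only)] -/
theorem size_le_of_stepHistOn {e : (k : ℕ) → (Fin (k + 1) → ℝ) → ℝ} {θ b₀ b₁ Λ γ γbar : ℝ}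
    (hθ : 0 ≤ θ) (hb₀ : 0 ≤ b₀) (hb₁ : 0 ≤ b₁) (hΛ : 0 ≤ Λ) (hγ : 0 ≤ γ) (hγbar : γ ≤ γbar) (hgap : θ + γ * Λ < 1)
    (hstep : ∀ (k : ℕ) (v : Fin (k + 2) → ℝ) (E : ℝ), v ∈ Box γbar (k + 1) → 0 ≤ E →
      (∀ (j : ℕ) (hj : j + 1 ≤ k + 1), e j (fun i => v (Fin.castLE (hj.trans (Nat.le_succ _)) i)) ≤ E) →
      e (k + 1) v ≤ θ * E + b₀ + v (Fin.last (k + 1)) * (b₁ + Λ * E))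
    (hbase : ∀ v : Fin 1 → ℝ, v ∈ Box γbar 0 → e 0 v ≤ b₀ + v 0 * b₁) :
    ∀ (k : ℕ) (v : Fin (k + 1) → ℝ), v ∈ Box γ k → e k v ≤ (b₀ + γ * b₁) / (1 - θ - γ * Λ) := by
  set M := (b₀ + γ * b₁) / (1 - θ - γ * Λ) with hMdef
  have hM : 0 ≤ M := gronwall_level_nonneg hb₀ hb₁ hγ hgap
  have hfix : θ * M + b₀ + γ * (b₁ + Λ * M) = M := gronwall_fixedPoint hgap
  intro k
  induction k using Nat.strong_induction_on with
  | _ k ih =>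
    intro v hv
    cases k with
    | zero =>
      have h0 := (mem_box_iff.mp hv) 0
      calc e 0 v ≤ b₀ + v 0 * b₁ := hbase v (box_mono hγbar hv)
        _ ≤ b₀ + γ * b₁ := by nlinarith [h0.2, h0.1]
        _ ≤ θ * M + b₀ + γ * (b₁ + Λ * M) := by nlinarith [mul_nonneg hθ hM, mul_nonneg hγ (mul_nonneg hΛ hM)]
        _ = M := hfix
    | succ k =>
      have hlast := (mem_box_iff.mp hv) (Fin.last (k + 1))
      have hprev : ∀ (j : ℕ) (hj : j + 1 ≤ k + 1), e j (fun i => v (Fin.castLE (hj.trans (Nat.le_succ _)) i)) ≤ M :=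
        fun j hj => ih j (by omega) _ (trunc_mem_box hv _)
      have hsrc0 : 0 ≤ b₁ + Λ * M := by positivity
      calc e (k + 1) v ≤ θ * M + b₀ + v (Fin.last (k + 1)) * (b₁ + Λ * M) := hstep k v M (box_mono hγbar hv) hM hprev
        _ ≤ θ * M + b₀ + γ * (b₁ + Λ * M) := by
            have := mul_le_mul_of_nonneg_right hlast.2 hsrc0
            linarith
        _ = M := hfix

/-- **DISCRETE GRÖNWALL — LAST-LEVEL ROW** (lens-2's `StepContractionOn` with a constant source `b₀`): `e (k+1) v ≤ θ·e k (init v) + b₀ + g_{k+1}(b₁ + Λ·e k (init v))` on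
`Box γ̄` + base ⟹ the same uniform level on every `Box γ`, `γ ≤ γ̄`, `θ + γΛ < 1` (the last-level row implies the full-memory row by monotonicity in `E`). [folklore] -/
theorem size_le_of_stepLastOn {e : (k : ℕ) → (Fin (k + 1) → ℝ) → ℝ} {θ b₀ b₁ Λ γ γbar : ℝ}
    (hθ : 0 ≤ θ) (hb₀ : 0 ≤ b₀) (hb₁ : 0 ≤ b₁) (hΛ : 0 ≤ Λ) (hγ : 0 ≤ γ) (hγbar : γ ≤ γbar) (hgap : θ + γ * Λ < 1)
    (hstep : ∀ (k : ℕ) (v : Fin (k + 2) → ℝ), v ∈ Box γbar (k + 1) →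
      e (k + 1) v ≤ θ * e k (Fin.init v) + b₀ + v (Fin.last (k + 1)) * (b₁ + Λ * e k (Fin.init v)))
    (hbase : ∀ v : Fin 1 → ℝ, v ∈ Box γbar 0 → e 0 v ≤ b₀ + v 0 * b₁) :
    ∀ (k : ℕ) (v : Fin (k + 1) → ℝ), v ∈ Box γ k → e k v ≤ (b₀ + γ * b₁) / (1 - θ - γ * Λ) := by
  refine size_le_of_stepHistOn hθ hb₀ hb₁ hΛ hγ hγbar hgap (fun k v E hv hE hprev => ?_) hbase
  have hk : e k (Fin.init v) ≤ E := by
    rw [init_eq_trunc]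
    exact hprev k le_rfl
  have hlast := ((mem_box_iff.mp hv) (Fin.last (k + 1))).1.le
  calc e (k + 1) v ≤ θ * e k (Fin.init v) + b₀ + v (Fin.last (k + 1)) * (b₁ + Λ * e k (Fin.init v)) := hstep k v hv
    _ ≤ θ * E + b₀ + v (Fin.last (k + 1)) * (b₁ + Λ * E) := by
        have h1 : θ * e k (Fin.init v) ≤ θ * E := mul_le_mul_of_nonneg_left hk hθ
        have h2 : b₁ + Λ * e k (Fin.init v) ≤ b₁ + Λ * E := by gcongr
        have h3 := mul_le_mul_of_nonneg_left h2 hlast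
        linarith

/-! ## §2. The readout row: from a uniform size level to the sign-free |β| box -/

/-- **READOUT**: a uniform size level `M` on `Box γ`, the readout row `|β_{k+1}(v) − b_{k+1}| ≤ A₀ + A·e_k(init v) + g_{k+1}(a₀ + a₁·e_k(init v))` on `Box γ̄`, the base readout
`|β_0(v) − b_0| ≤ A₀ + g_0·a₀` and the cap `|b_k| ≤ B` give `|β_k(v)| ≤ B + A₀ + A·M + γ(a₀ + a₁M)` on every `Box γ`, `γ ≤ γ̄` (a constant slack `A₀` is carried so
that a SECOND size tier already bounded uniformly — CRIT-1's two-tier triangular system, row E then row e — is absorbed into `A₀` and the source `b₀`). [folklore; cite: Balaban1987RG1, (1.20)–(1.22) p.264 (shape of the readout only)] -/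
theorem abs_le_of_readoutOn {β : HBeta} {b : ℕ → ℝ} {e : (k : ℕ) → (Fin (k + 1) → ℝ) → ℝ} {M γ γbar A₀ A a₀ a₁ B : ℝ}
    (hM : 0 ≤ M) (hγ : 0 ≤ γ) (hγbar : γ ≤ γbar) (hA : 0 ≤ A) (ha₀ : 0 ≤ a₀) (ha₁ : 0 ≤ a₁)
    (hsize : ∀ (k : ℕ) (v : Fin (k + 1) → ℝ), v ∈ Box γ k → e k v ≤ M)
    (hread0 : ∀ v : Fin 1 → ℝ, v ∈ Box γbar 0 → |β 0 v - b 0| ≤ A₀ + v 0 * a₀)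
    (hread : ∀ (k : ℕ) (v : Fin (k + 2) → ℝ), v ∈ Box γbar (k + 1) →
      |β (k + 1) v - b (k + 1)| ≤ A₀ + A * e k (Fin.init v) + v (Fin.last (k + 1)) * (a₀ + a₁ * e k (Fin.init v)))
    (hcap : ∀ k, |b k| ≤ B) :
    ∀ (k : ℕ) (v : Fin (k + 1) → ℝ), v ∈ Box γ k → |β k v| ≤ B + A₀ + A * M + γ * (a₀ + a₁ * M) := by
  intro k v hv
  cases k with
  | zero =>
    have h0 := (mem_box_iff.mp hv) 0
    have hr : |β 0 v - b 0| ≤ A₀ + v 0 * a₀ := hread0 v (box_mono hγbar hv)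
    have hr' : v 0 * a₀ ≤ γ * a₀ := mul_le_mul_of_nonneg_right h0.2 ha₀
    have hc := hcap 0
    have hAM : 0 ≤ A * M := mul_nonneg hA hM
    have hγaM : 0 ≤ γ * (a₁ * M) := mul_nonneg hγ (mul_nonneg ha₁ hM)
    have htri : |β 0 v| ≤ |β 0 v - b 0| + |b 0| := by
      have := abs_add_le (β 0 v - b 0) (b 0); simpa using this
    nlinarith
  | succ k =>
    have hlast := (mem_box_iff.mp hv) (Fin.last (k + 1))
    have he : e k (Fin.init v) ≤ M := hsize k (Fin.init v) (init_mem_box hv)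
    have hr := hread k v (box_mono hγbar hv)
    have hc := hcap (k + 1)
    have h1 : A * e k (Fin.init v) ≤ A * M := mul_le_mul_of_nonneg_left he hA
    have hsrc : a₀ + a₁ * e k (Fin.init v) ≤ a₀ + a₁ * M := by gcongr
    have hsrc0 : 0 ≤ a₀ + a₁ * M := by positivity
    have h2 : v (Fin.last (k + 1)) * (a₀ + a₁ * e k (Fin.init v)) ≤ γ * (a₀ + a₁ * M) :=
      calc v (Fin.last (k + 1)) * (a₀ + a₁ * e k (Fin.init v))
          ≤ v (Fin.last (k + 1)) * (a₀ + a₁ * M) := mul_le_mul_of_nonneg_left hsrc hlast.1.le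
        _ ≤ γ * (a₀ + a₁ * M) := mul_le_mul_of_nonneg_right hlast.2 hsrc0
    have htri : |β (k + 1) v| ≤ |β (k + 1) v - b (k + 1)| + |b (k + 1)| := by
      have := abs_add_le (β (k + 1) v - b (k + 1)) (b (k + 1)); simpa using this
    linarith

/-- The same as the two K0 clauses `BetaLowerH (−β′) γ β ∧ BetaUpperH β′ γ β`, `β′ = B + A₀ + A·M + γ(a₀ + a₁M)`. [folklore; cite: Balaban1987RG1, §1 p.264 (bookkeeping)] -/
theorem betaBox_of_readoutOn {β : HBeta} {b : ℕ → ℝ} {e : (k : ℕ) → (Fin (k + 1) → ℝ) → ℝ} {M γ γbar A₀ A a₀ a₁ B : ℝ}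
    (hM : 0 ≤ M) (hγ : 0 ≤ γ) (hγbar : γ ≤ γbar) (hA : 0 ≤ A) (ha₀ : 0 ≤ a₀) (ha₁ : 0 ≤ a₁)
    (hsize : ∀ (k : ℕ) (v : Fin (k + 1) → ℝ), v ∈ Box γ k → e k v ≤ M)
    (hread0 : ∀ v : Fin 1 → ℝ, v ∈ Box γbar 0 → |β 0 v - b 0| ≤ A₀ + v 0 * a₀)
    (hread : ∀ (k : ℕ) (v : Fin (k + 2) → ℝ), v ∈ Box γbar (k + 1) →
      |β (k + 1) v - b (k + 1)| ≤ A₀ + A * e k (Fin.init v) + v (Fin.last (k + 1)) * (a₀ + a₁ * e k (Fin.init v)))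
    (hcap : ∀ k, |b k| ≤ B) :
    BetaLowerH (-(B + A₀ + A * M + γ * (a₀ + a₁ * M))) γ β ∧ BetaUpperH (B + A₀ + A * M + γ * (a₀ + a₁ * M)) γ β := by
  have habs := abs_le_of_readoutOn hM hγ hγbar hA ha₀ ha₁ hsize hread0 hread hcap
  exact ⟨fun k v hv => (abs_le.mp (habs k v hv)).1, fun k v hv => (abs_le.mp (habs k v hv)).2⟩

/-- **★ THE FOUR ROWS ⟹ THE BOX** (full-memory step row, base, readout + cap), all on `Box γ̄`, read on `Box γ` (`γ ≤ γ̄`, `θ + γΛ < 1`): `BetaLowerH (−β′) γ β ∧ BetaUpperH β′ γ β`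
with `β′ = B + A₀ + A·M + γ(a₀ + a₁M)`, `M = (b₀ + γb₁)/(1 − θ − γΛ)`. [folklore; cite: Balaban1987RG1, §1 p.264, (1.18) p.263 (shapes only)] -/
theorem betaBox_of_flowRowsHistOn {β : HBeta} {b : ℕ → ℝ} {e : (k : ℕ) → (Fin (k + 1) → ℝ) → ℝ} {θ b₀ b₁ Λ γ γbar A₀ A a₀ a₁ B : ℝ}
    (hθ : 0 ≤ θ) (hb₀ : 0 ≤ b₀) (hb₁ : 0 ≤ b₁) (hΛ : 0 ≤ Λ) (hγ : 0 ≤ γ) (hγbar : γ ≤ γbar) (hgap : θ + γ * Λ < 1)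
    (hA : 0 ≤ A) (ha₀ : 0 ≤ a₀) (ha₁ : 0 ≤ a₁)
    (hstep : ∀ (k : ℕ) (v : Fin (k + 2) → ℝ) (E : ℝ), v ∈ Box γbar (k + 1) → 0 ≤ E →
      (∀ (j : ℕ) (hj : j + 1 ≤ k + 1), e j (fun i => v (Fin.castLE (hj.trans (Nat.le_succ _)) i)) ≤ E) →
      e (k + 1) v ≤ θ * E + b₀ + v (Fin.last (k + 1)) * (b₁ + Λ * E))
    (hbase : ∀ v : Fin 1 → ℝ, v ∈ Box γbar 0 → e 0 v ≤ b₀ + v 0 * b₁)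
    (hread0 : ∀ v : Fin 1 → ℝ, v ∈ Box γbar 0 → |β 0 v - b 0| ≤ A₀ + v 0 * a₀)
    (hread : ∀ (k : ℕ) (v : Fin (k + 2) → ℝ), v ∈ Box γbar (k + 1) →
      |β (k + 1) v - b (k + 1)| ≤ A₀ + A * e k (Fin.init v) + v (Fin.last (k + 1)) * (a₀ + a₁ * e k (Fin.init v)))
    (hcap : ∀ k, |b k| ≤ B) :
    BetaLowerH (-(B + A₀ + A * ((b₀ + γ * b₁) / (1 - θ - γ * Λ)) + γ * (a₀ + a₁ * ((b₀ + γ * b₁) / (1 - θ - γ * Λ))))) γ β ∧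
      BetaUpperH (B + A₀ + A * ((b₀ + γ * b₁) / (1 - θ - γ * Λ)) + γ * (a₀ + a₁ * ((b₀ + γ * b₁) / (1 - θ - γ * Λ)))) γ β :=
  betaBox_of_readoutOn (gronwall_level_nonneg hb₀ hb₁ hγ hgap) hγ hγbar hA ha₀ ha₁
    (size_le_of_stepHistOn hθ hb₀ hb₁ hΛ hγ hγbar hgap hstep hbase) hread0 hread hcap

/-! ## §3. LOCATED-B BY NAME: the four rows at the stub's own member ⟹ the registered V23 stub-3ᴬ′ᴮ text -/

/-- **★★ THE FLOW-GRÖNWALL ROWS AT EACH MEMBER ⟹ `AbsBetaBoxAtThm1WitnessCCMGenGridGZBAt F`.**  For every member `(j; B₃ ≥ 2L², B₃′ > 0, a₀ > 0, a₁ > 0)` of the stub's family let there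
be window tokens `ε₀, ε₂₉ > 0`, box sides `0 < γ ≤ γ̄` and flow data (a history-indexed size functional `e`, a centre sequence `b`, constants `θ, b₀, b₁, Λ, A, a₀′, a₁′, B ≥ 0`, a slack `A₀`, with
`θ + γΛ < 1`) carrying the FOUR ROWS on `Box γ̄` for that member's β of record `betaOfRecord₁₃ F 2 (theta13OfThm1CCMWZB F 2 j (1/2) a₀ ε₀ ε₂₉ B₃ B₃' a₀ a₁ 0 0)` — full-memory step,
base, readout (+ base readout), cap.  Then the registered stub-3ᴬ′ᴮ text holds at `F` (the grid letters `c, c₀, c₁` and the ᴮ (8)∕(9) antecedents are not used; `β′`, `γ₀ := γ` are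
∃-chosen per member, as the text allows).  CONDITIONAL on the rows — with `e` the record's pinned size functional the step row is NODE O's wall at one step; nothing of Bałaban
asserted; K0⁷ NOT closed. [cite: Balaban1987RG1, Thm 1 p.259, §1 p.264, (1.18) p.263, (1.20)–(1.22) p.264; Balaban1985Variational, Thm 1 (8),(9) p.279; Balaban1989LargeFieldII, p.355] -/
theorem absBetaBoxGZBAt_of_flowRowsHistAt (F : T4Family)
    (h : ∀ (j : ℕ) (B₃ B₃' a₀ a₁ : ℝ), 2 * (F.L : ℝ) ^ 2 ≤ B₃ → 0 < B₃' → 0 < a₀ → 0 < a₁ →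
      ∃ (ε₀ ε₂₉ γ γbar : ℝ) (e : (k : ℕ) → (Fin (k + 1) → ℝ) → ℝ) (b : ℕ → ℝ) (θ b₀ b₁ Λ A₀ A a₀' a₁' B : ℝ),
        0 < ε₀ ∧ 0 < ε₂₉ ∧ 0 < γ ∧ γ ≤ γbar ∧ 0 ≤ θ ∧ 0 ≤ b₀ ∧ 0 ≤ b₁ ∧ 0 ≤ Λ ∧ θ + γ * Λ < 1 ∧ 0 ≤ A ∧ 0 ≤ a₀' ∧ 0 ≤ a₁' ∧
        letI β : HBeta := betaOfRecord₁₃ F 2 (theta13OfThm1CCMWZB F 2 j (1 / 2) a₀ ε₀ ε₂₉ B₃ B₃' a₀ a₁ (fun _ _ => 0) (fun _ _ => 0))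
        (∀ (k : ℕ) (v : Fin (k + 2) → ℝ) (E : ℝ), v ∈ Box γbar (k + 1) → 0 ≤ E →
          (∀ (i : ℕ) (hi : i + 1 ≤ k + 1), e i (fun t => v (Fin.castLE (hi.trans (Nat.le_succ _)) t)) ≤ E) →
          e (k + 1) v ≤ θ * E + b₀ + v (Fin.last (k + 1)) * (b₁ + Λ * E)) ∧
        (∀ v : Fin 1 → ℝ, v ∈ Box γbar 0 → e 0 v ≤ b₀ + v 0 * b₁) ∧
        (∀ v : Fin 1 → ℝ, v ∈ Box γbar 0 → |β 0 v - b 0| ≤ A₀ + v 0 * a₀') ∧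
        (∀ (k : ℕ) (v : Fin (k + 2) → ℝ), v ∈ Box γbar (k + 1) →
          |β (k + 1) v - b (k + 1)| ≤ A₀ + A * e k (Fin.init v) + v (Fin.last (k + 1)) * (a₀' + a₁' * e k (Fin.init v))) ∧
        (∀ k, |b k| ≤ B)) :
    AbsBetaBoxAtThm1WitnessCCMGenGridGZBAt F := by
  intro j c c₀ c₁ B₃ B₃' a₀ a₁ _hc _hc₀ _hc₁ hB₃ hB₃' ha₀ ha₁ _h15 _h9
  obtain ⟨ε₀, ε₂₉, γ, γbar, e, b, θ, b₀, b₁, Λ, A₀, A, a₀', a₁', B, hε₀, hε₂₉, hγ, hγbar, hθ, hb₀, hb₁, hΛ, hgap, hA, ha₀', ha₁',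
    hstep, hbase, hread0, hread, hcap⟩ := h j B₃ B₃' a₀ a₁ hB₃ hB₃' ha₀ ha₁
  obtain ⟨hlo, hup⟩ := betaBox_of_flowRowsHistOn hθ hb₀ hb₁ hΛ hγ.le hγbar hgap hA ha₀' ha₁' hstep hbase hread0 hread hcap
  exact ⟨γ, ε₀, ε₂₉, _, hγ, hε₀, hε₂₉, hlo, hup⟩

/-- **THE LAST-LEVEL EDITION** (lens-2's `StepContractionOn`-shaped step row, with a constant source `b₀`): the same door. [cite: Balaban1987RG1, Thm 1 p.259, §1 p.264, (1.18) p.263; Balaban1985Variational, Thm 1 (8),(9) p.279] -/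
theorem absBetaBoxGZBAt_of_flowRowsLastAt (F : T4Family)
    (h : ∀ (j : ℕ) (B₃ B₃' a₀ a₁ : ℝ), 2 * (F.L : ℝ) ^ 2 ≤ B₃ → 0 < B₃' → 0 < a₀ → 0 < a₁ →
      ∃ (ε₀ ε₂₉ γ γbar : ℝ) (e : (k : ℕ) → (Fin (k + 1) → ℝ) → ℝ) (b : ℕ → ℝ) (θ b₀ b₁ Λ A₀ A a₀' a₁' B : ℝ),
        0 < ε₀ ∧ 0 < ε₂₉ ∧ 0 < γ ∧ γ ≤ γbar ∧ 0 ≤ θ ∧ 0 ≤ b₀ ∧ 0 ≤ b₁ ∧ 0 ≤ Λ ∧ θ + γ * Λ < 1 ∧ 0 ≤ A ∧ 0 ≤ a₀' ∧ 0 ≤ a₁' ∧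
        letI β : HBeta := betaOfRecord₁₃ F 2 (theta13OfThm1CCMWZB F 2 j (1 / 2) a₀ ε₀ ε₂₉ B₃ B₃' a₀ a₁ (fun _ _ => 0) (fun _ _ => 0))
        (∀ (k : ℕ) (v : Fin (k + 2) → ℝ), v ∈ Box γbar (k + 1) →
          e (k + 1) v ≤ θ * e k (Fin.init v) + b₀ + v (Fin.last (k + 1)) * (b₁ + Λ * e k (Fin.init v))) ∧
        (∀ v : Fin 1 → ℝ, v ∈ Box γbar 0 → e 0 v ≤ b₀ + v 0 * b₁) ∧
        (∀ v : Fin 1 → ℝ, v ∈ Box γbar 0 → |β 0 v - b 0| ≤ A₀ + v 0 * a₀') ∧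
        (∀ (k : ℕ) (v : Fin (k + 2) → ℝ), v ∈ Box γbar (k + 1) →
          |β (k + 1) v - b (k + 1)| ≤ A₀ + A * e k (Fin.init v) + v (Fin.last (k + 1)) * (a₀' + a₁' * e k (Fin.init v))) ∧
        (∀ k, |b k| ≤ B)) :
    AbsBetaBoxAtThm1WitnessCCMGenGridGZBAt F := by
  intro j c c₀ c₁ B₃ B₃' a₀ a₁ _hc _hc₀ _hc₁ hB₃ hB₃' ha₀ ha₁ _h15 _h9
  obtain ⟨ε₀, ε₂₉, γ, γbar, e, b, θ, b₀, b₁, Λ, A₀, A, a₀', a₁', B, hε₀, hε₂₉, hγ, hγbar, hθ, hb₀, hb₁, hΛ, hgap, hA, ha₀', ha₁',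
    hstep, hbase, hread0, hread, hcap⟩ := h j B₃ B₃' a₀ a₁ hB₃ hB₃' ha₀ ha₁
  have hsize := size_le_of_stepLastOn hθ hb₀ hb₁ hΛ hγ.le hγbar hgap hstep hbase
  obtain ⟨hlo, hup⟩ := betaBox_of_readoutOn (gronwall_level_nonneg hb₀ hb₁ hγ.le hgap) hγ.le hγbar hA ha₀' ha₁' hsize hread0 hread hcap
  exact ⟨γ, ε₀, ε₂₉, _, hγ, hε₀, hε₂₉, hlo, hup⟩

/-! ## §4. RADIUS-AXIS EDITION (director-ym №398∕№399: a g1 line ends through the WEAKEST radius door): the rows at ONE member per SMALL radius ⟹ the body of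
door (α_small) `K0BoxSmallRadii` at `F`, UNFOLDED (the named door lives in the NODE O definer's leaf `…K0V23Stub3DoorSuppliers`; composing is one `fun F => …` line there) -/

/-- **★★ FLOW ROWS AT ONE MEMBER PER SMALL RADIUS ⟹ DOOR (α_small) AT `F`, UNFOLDED.**  If below some `a⋆ > 0` every background radius `a₀ ∈ ]0, a⋆]` admits ONE Z3 member
`θ₁₃ᶜᶜᴹᵂᶻᴮ(j; ½; a₀; ε₀, ε₂₉; B₃, B₃′, a₀, a₁; Efl, logz)` (`ε₂₉ > 0`), box sides `0 < γ ≤ γ̄` and flow data carrying the FOUR ROWS (full-memory step, base, readout + base readout, cap) for that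
member's β of record, then `F` has the body of door (α_small): `∃ a⋆ > 0, ∀ a₀ ∈ ]0, a⋆], ∃ γ₀ ε₂₉ β′ j ε₀ B₃ B₃′ a₁ Efl logz, 0 < γ₀ ∧ 0 < ε₂₉ ∧ BetaLowerH (−β′) γ₀ β ∧ BetaUpperH β′ γ₀ β`.
The rows are asked ONLY at radii `≤ a⋆` and at ONE member each (no `∀ a₀ > 0`, no `∀ j …`).  CONDITIONAL on the rows; nothing of Bałaban asserted; K0⁷ NOT closed.
[cite: Balaban1987RG1, Thm 1 p.259, Thm 3 p.264, (1.18) p.263, (1.20)–(1.22) p.264; Balaban1989LargeFieldII, p.355] -/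
theorem k0BoxSmallRadiiAt_of_flowRowsHist (F : T4Family) {aS : ℝ} (haS : 0 < aS)
    (h : ∀ a₀ : ℝ, 0 < a₀ → a₀ ≤ aS →
      ∃ (j : ℕ) (ε₀ ε₂₉ B₃ B₃' a₁ : ℝ) (Efl logz : B12.RunParams → ℕ → ℝ) (γ γbar : ℝ)
        (e : (k : ℕ) → (Fin (k + 1) → ℝ) → ℝ) (b : ℕ → ℝ) (θ b₀ b₁ Λ A₀ A a₀' a₁' B : ℝ),
        0 < ε₂₉ ∧ 0 < γ ∧ γ ≤ γbar ∧ 0 ≤ θ ∧ 0 ≤ b₀ ∧ 0 ≤ b₁ ∧ 0 ≤ Λ ∧ θ + γ * Λ < 1 ∧ 0 ≤ A ∧ 0 ≤ a₀' ∧ 0 ≤ a₁' ∧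
        letI β : HBeta := betaOfRecord₁₃ F 2 (theta13OfThm1CCMWZB F 2 j (1 / 2) a₀ ε₀ ε₂₉ B₃ B₃' a₀ a₁ Efl logz)
        (∀ (k : ℕ) (v : Fin (k + 2) → ℝ) (E : ℝ), v ∈ Box γbar (k + 1) → 0 ≤ E →
          (∀ (i : ℕ) (hi : i + 1 ≤ k + 1), e i (fun t => v (Fin.castLE (hi.trans (Nat.le_succ _)) t)) ≤ E) →
          e (k + 1) v ≤ θ * E + b₀ + v (Fin.last (k + 1)) * (b₁ + Λ * E)) ∧
        (∀ v : Fin 1 → ℝ, v ∈ Box γbar 0 → e 0 v ≤ b₀ + v 0 * b₁) ∧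
        (∀ v : Fin 1 → ℝ, v ∈ Box γbar 0 → |β 0 v - b 0| ≤ A₀ + v 0 * a₀') ∧
        (∀ (k : ℕ) (v : Fin (k + 2) → ℝ), v ∈ Box γbar (k + 1) →
          |β (k + 1) v - b (k + 1)| ≤ A₀ + A * e k (Fin.init v) + v (Fin.last (k + 1)) * (a₀' + a₁' * e k (Fin.init v))) ∧
        (∀ k, |b k| ≤ B)) :
    ∃ aS : ℝ, 0 < aS ∧ ∀ a₀ : ℝ, 0 < a₀ → a₀ ≤ aS →
      ∃ (γ₀ ε₂₉ β' : ℝ) (j : ℕ) (ε₀ B₃ B₃' a₁ : ℝ) (Efl logz : B12.RunParams → ℕ → ℝ), 0 < γ₀ ∧ 0 < ε₂₉ ∧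
        BetaLowerH (-β') γ₀ (betaOfRecord₁₃ F 2 (theta13OfThm1CCMWZB F 2 j (1 / 2) a₀ ε₀ ε₂₉ B₃ B₃' a₀ a₁ Efl logz)) ∧
        BetaUpperH β' γ₀ (betaOfRecord₁₃ F 2 (theta13OfThm1CCMWZB F 2 j (1 / 2) a₀ ε₀ ε₂₉ B₃ B₃' a₀ a₁ Efl logz)) := by
  refine ⟨aS, haS, fun a₀ ha₀ hle => ?_⟩
  obtain ⟨j, ε₀, ε₂₉, B₃, B₃', a₁, Efl, logz, γ, γbar, e, b, θ, b₀, b₁, Λ, A₀, A, a₀', a₁', B, hε₂₉, hγ, hγbar, hθ, hb₀, hb₁, hΛ, hgap, hA, ha₀',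
    ha₁', hstep, hbase, hread0, hread, hcap⟩ := h a₀ ha₀ hle
  obtain ⟨hlo, hup⟩ := betaBox_of_flowRowsHistOn hθ hb₀ hb₁ hΛ hγ.le hγbar hgap hA ha₀' ha₁' hstep hbase hread0 hread hcap
  exact ⟨γ, ε₂₉, _, j, ε₀, B₃, B₃', a₁, Efl, logz, hγ, hε₂₉, hlo, hup⟩

/-! ## §5. (v1.1, APPEND-ONLY) FORMAT-PREDICATE EDITIONS — the shape of lens-2's LINE «Grönwall on the wall itself» (HOME `nodeO-cover/LENS-2-Line-flow-gronwall-ttel.lean`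
v3.11∕v3.12, director-ym №408∕№409, CRIT-1 (P3b)(1)): a level-wise FORMAT predicate `Fmt k v E` («the accumulated level-`k` term at history `v` is in format (1.18) with constant `E`»),
monotone in `E`, reproduced one step down with contraction — last-level form with a base, or FULL-MEMORY form (no separate base) — ⟹ the format holds with ONE k-uniform constant on every
`Box γ`.  §1 is the instance `Fmt k v E := (e k v ≤ E)`.  Tree home of the predicate-Grönwall the line composes with lens-1's road and DEF-1's door (α_small); 0 `def` (the predicate is a
bound variable). -/

/-- The last-level format fixed point: `ρ·M + σ₀ + g·b₁ ≤ M` for `M = max B₀ ((σ₀ + γb₁)/(1 − ρ))`, `g ≤ γ`, `ρ < 1`, `b₁ ≥ 0`. [folklore] -/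
theorem fmt_level_step_le {ρ B₀ σ₀ b₁ γ g : ℝ} (hρ : ρ < 1) (hb₁ : 0 ≤ b₁) (hg : g ≤ γ) :
    ρ * max B₀ ((σ₀ + γ * b₁) / (1 - ρ)) + σ₀ + g * b₁ ≤ max B₀ ((σ₀ + γ * b₁) / (1 - ρ)) := by
  set M := max B₀ ((σ₀ + γ * b₁) / (1 - ρ)) with hM
  have hMge : (σ₀ + γ * b₁) / (1 - ρ) ≤ M := le_max_right _ _
  have h1 : 0 < 1 - ρ := by linarith
  have hkey : σ₀ + γ * b₁ ≤ (1 - ρ) * M := by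
    have := (div_le_iff₀ h1).mp hMge
    linarith [this]
  nlinarith [mul_le_mul_of_nonneg_right hg hb₁]

/-- **★ PREDICATE GRÖNWALL, LAST-LEVEL FORM** (lens-2 LINE §16 `fmt_uniform_of_step` shape): a format predicate monotone in its constant, in format `B₀ ≥ 0` at level `0` on `Box γ̄`, and
reproduced one step down as `E ↦ ρE + σ₀ + g_{k+1}b₁` (`ρ < 1`, `b₁ ≥ 0`, any input constant `E ≥ 0`) holds at EVERY level on every `Box γ`, `γ ≤ γ̄`, with the ONE constant
`max B₀ ((σ₀ + γb₁)/(1 − ρ))`. [folklore; cite: Balaban1987RG1, Thm 3 p.264, (1.18) p.263, (5.36)–(5.44) pp.297–298 (shape of the inductive step only)] -/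
theorem fmt_uniform_of_fmtStep {Fmt : (k : ℕ) → (Fin (k + 1) → ℝ) → ℝ → Prop} {γ γbar ρ B₀ σ₀ b₁ : ℝ}
    (hγbar : γ ≤ γbar) (hρ : ρ < 1) (hB₀ : 0 ≤ B₀) (hb₁ : 0 ≤ b₁)
    (hmono : ∀ (k : ℕ) (v : Fin (k + 1) → ℝ) (E E' : ℝ), E ≤ E' → Fmt k v E → Fmt k v E')
    (hbase : ∀ v : Fin 1 → ℝ, v ∈ Box γbar 0 → Fmt 0 v B₀)
    (hstep : ∀ (k : ℕ) (v : Fin (k + 2) → ℝ) (E : ℝ), v ∈ Box γbar (k + 1) → 0 ≤ E → Fmt k (Fin.init v) E →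
      Fmt (k + 1) v (ρ * E + σ₀ + v (Fin.last (k + 1)) * b₁)) :
    ∀ (k : ℕ) (v : Fin (k + 1) → ℝ), v ∈ Box γ k → Fmt k v (max B₀ ((σ₀ + γ * b₁) / (1 - ρ))) := by
  have hMnn : 0 ≤ max B₀ ((σ₀ + γ * b₁) / (1 - ρ)) := hB₀.trans (le_max_left _ _)
  intro k
  induction k with
  | zero =>
    intro v hv
    exact hmono 0 v _ _ (le_max_left _ _) (hbase v (box_mono hγbar hv))
  | succ k ih =>
    intro v hv
    have hlast := (mem_box_iff.mp hv) (Fin.last (k + 1))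
    have h1 := hstep k v _ (box_mono hγbar hv) hMnn (ih (Fin.init v) (init_mem_box hv))
    exact hmono _ _ _ _ (fmt_level_step_le hρ hb₁ hlast.2) h1

/-- The full-memory format fixed point: `ρ·M + σ₀ + g·b₁ ≤ M` for `M = (σ₀ + γb₁)/(1 − ρ)`, `g ≤ γ`. [folklore] -/
theorem fmt_mem_step_le {ρ σ₀ b₁ γ g : ℝ} (hρ : ρ < 1) (hb₁ : 0 ≤ b₁) (hg : g ≤ γ) :
    ρ * ((σ₀ + γ * b₁) / (1 - ρ)) + σ₀ + g * b₁ ≤ (σ₀ + γ * b₁) / (1 - ρ) := by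
  have h1 : 0 < 1 - ρ := by linarith
  set M := (σ₀ + γ * b₁) / (1 - ρ) with hM
  have hkey : M * (1 - ρ) = σ₀ + γ * b₁ := by rw [hM]; exact div_mul_cancel₀ _ (ne_of_gt h1)
  have hkey' : M - ρ * M = σ₀ + γ * b₁ := by rw [← hkey]; ring
  linarith [hkey', mul_le_mul_of_nonneg_right hg hb₁]

/-- **★★ PREDICATE GRÖNWALL, FULL-MEMORY FORM** (lens-2 LINE `fmt_uniform_of_stepMem` shape = CRIT-1 (P3b)(1) «the line's ONE stub»): if, whenever every OLDER generation `j < n` of a box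
history is in format `E ≥ 0` at the restricted histories, generation `n` is in format `ρE + σ₀ + g_n b₁` (at `n = 0` the memory is empty — the first step is included, no separate base),
then EVERY generation is in format `(σ₀ + γb₁)/(1 − ρ)` on every `Box γ`, `γ ≤ γ̄` (`ρ < 1`, `σ₀, b₁, γ ≥ 0`; strong induction). [folklore; cite: Balaban1987RG1, Thm 3 p.264, (1.7) p.261, (1.18) p.263 (shape only)] -/
theorem fmt_uniform_of_fmtStepMem {Fmt : (k : ℕ) → (Fin (k + 1) → ℝ) → ℝ → Prop} {γ γbar ρ σ₀ b₁ : ℝ}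
    (hγ : 0 ≤ γ) (hγbar : γ ≤ γbar) (hρ : ρ < 1) (hσ₀ : 0 ≤ σ₀) (hb₁ : 0 ≤ b₁)
    (hmono : ∀ (k : ℕ) (v : Fin (k + 1) → ℝ) (E E' : ℝ), E ≤ E' → Fmt k v E → Fmt k v E')
    (hstep : ∀ (n : ℕ) (v : Fin (n + 1) → ℝ) (E : ℝ), v ∈ Box γbar n → 0 ≤ E →
      (∀ (j : ℕ) (hj : j < n), Fmt j (fun i => v (Fin.castLE (by omega) i)) E) → Fmt n v (ρ * E + σ₀ + v (Fin.last n) * b₁)) :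
    ∀ (n : ℕ) (v : Fin (n + 1) → ℝ), v ∈ Box γ n → Fmt n v ((σ₀ + γ * b₁) / (1 - ρ)) := by
  have hMnn : 0 ≤ (σ₀ + γ * b₁) / (1 - ρ) := div_nonneg (by positivity) (by linarith)
  intro n
  induction n using Nat.strong_induction_on with
  | _ n ih =>
    intro v hv
    have hlast := (mem_box_iff.mp hv) (Fin.last n)
    have h := hstep n v _ (box_mono hγbar hv) hMnn (fun j hj => ih j hj _ (trunc_mem_box hv (by omega)))
    exact hmono _ _ _ _ (fmt_mem_step_le hρ hb₁ hlast.2) h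

/-- §1 IS AN INSTANCE: a size functional `e` gives the format predicate `Fmt k v E := e k v ≤ E` (monotone), and the full-memory size row of §1 is the full-memory format step with
`ρ := θ + γ̄Λ`… — recorded here only in the simplest direction: the predicate conclusion for `Fmt := (e · · ≤ ·)` IS a uniform size bound. [folklore] -/
theorem size_le_of_fmt_uniform {e : (k : ℕ) → (Fin (k + 1) → ℝ) → ℝ} {γ M : ℝ}
    (h : ∀ (n : ℕ) (v : Fin (n + 1) → ℝ), v ∈ Box γ n → (fun k (v : Fin (k + 1) → ℝ) E => e k v ≤ E) n v M) :
    ∀ (n : ℕ) (v : Fin (n + 1) → ℝ), v ∈ Box γ n → e n v ≤ M := h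

end Summit.QuantumFields.YangMills.Theorems.K0V23Stub3FlowGronwallDoor

end
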